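import Literature.NumberTheory.Automorphic.WhittakerBesselGL2
import Literature.NumberTheory.Automorphic.WhittakerCoeffLocalDatum
import Literature.NumberTheory.Automorphic.NewformAdelisationDescent
import Literature.NumberTheory.Automorphic.RatIdeleCongruence
import Literature.NumberTheory.Automorphic.FiniteAdeleSchwartzBruhatFourier
import HarnessLib

/-!
# Whittaker coefficients on `GL₂(𝔸_ℚ)` along the finite-adelic mirabolic: torus translates,
# unipotent translates and the values of Tate's character on finite adeles

Topic `NumberTheory/Automorphic`; namespace `Literature.NumberTheory.Automorphic`. Elementary
support for the existence of the new vector (`GL2NewvectorExistence`; Casselman 1973, Thm. 1,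
existence half, proved there by global means): for a function `φ` on `GL₂(𝔸_ℚ)` which is left
`GL₂(ℚ)`-invariant, and its global `ψ`-Whittaker coefficient `W_φ` (`whittakerCoeff`, Cogdell 2004,
§1.1) with Tate's character `ψ = ψ_ℚ` (`adeleAddChar ℚ`), finite adeles being placed in `𝔸_ℚ` by the
tree's `finiteAdeleInr ℚ c = (0_∞, c)` (`FiniteAdeleSchwartzBruhatFourier`, with `ψ_f = finiteAdeleAddChar`)
and finite ideles by `Rat.finUnitHom y = (1_∞, y)` (`RatIdeleCongruence`):

* `GLn.ofFinite` of the finite-adelic unipotent `n(c)` and torus element `d(y) = diag(y, 1)` are the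
  adelic `n((0, c))` and `d((1, y))` (`ofFinite_unipotentGL2`, `ofFinite_diagGL2`);
* **`ψ_ℚ((0_∞, c)) = e^{2πi q}` if `c ≡ q (mod ẑ)` for a rational `q`**
  (`Rat.adeleAddChar_finiteAdeleInr_eq_of_sub_integral`, the case `K = ℚ`, `Tr = id` of the tree's
  `finiteAdeleAddChar_eq_of_forall_sub_mem`), and `ψ_ℚ((0, p⁻¹ at p)) = e^{2πi/p} ≠ 1`
  (`Rat.adeleAddChar_finiteAdeleInr_invPrimeSingle_ne_one`: the local conductor of `ψ_ℚ` at `p` is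
  exactly `ℤ_p`);
* **`W_φ((h, d(y) n(c))) = ψ((0, y c)) W_φ((h, d(y)))`** for `h ∈ GL₂(ℝ)`, `y ∈ (𝔸_ℚ^∞)ˣ`,
  `c ∈ 𝔸_ℚ^∞` (`whittakerCoeff_ofRealGL_mul_ofFinite_diagGL2_mul_unipotentGL2`: `d(y) n(c) = n(yc) d(y)`
  and the `N(𝔸)`-equivariance `whittakerCoeff_unipotent_mul`);
* **support**: if `φ` is right invariant under `n(ẑ)` and `ψ((0, y z)) ≠ 1` for some `z ∈ ẑ`, then
  `W_φ((h, d(y))) = 0` (`whittakerCoeff_ofRealGL_mul_ofFinite_diagGL2_eq_zero`); for `ψ = ψ_ℚ` such a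
  `z` exists as soon as `y` is not integral at some `p`
  (`Rat.exists_integral_adeleAddChar_finiteAdeleInr_mul_ne_one`).

Everything is proved; the only definition is the finite adele `Rat.invPrimeSingle v = (p⁻¹ at p, 0 elsewhere)`.

## References

* J. Tate, *Fourier analysis in number fields and Hecke's zeta-functions*, in Cassels–Fröhlich,
  *Algebraic Number Theory* (1967), Ch. XV, §2.2 (local `λ_p`), §4.1 [CasselsFrohlichANT1967].
* J. W. Cogdell, *Analytic theory of L-functions for GL_n*, in Bernstein–Gelbart (eds.),
  *An Introduction to the Langlands Program* (2004), §1.1 [CogdellAnalyticTheory2004].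
* W. Casselman, *On some results of Atkin and Lehner*, Math. Ann. 201 (1973), Thm. 1 and §1 [Casselman1973].
-/

noncomputable section

open MeasureTheory NumberField IsDedekindDomain Matrix
open scoped MatrixGroups ComplexConjugate

namespace Literature.NumberTheory.Automorphic

open IsDedekindDomain.HeightOneSpectrum Rat.HeightOneSpectrum
open Literature.NumberTheory.GaloisRepresentations (ideleGroup)

/-! ### Finite adeles and ideles inside `𝔸_ℚ`, `GL₂(𝔸_ℚ)` -/

section FinAdele

/-- `(1, y) · (0, c) = (0, y c)`. [folklore] -/
theorem Rat.coe_finUnitHom_mul_finiteAdeleInr (y : (FiniteAdeleRing (𝓞 ℚ) ℚ)ˣ) (c : FiniteAdeleRing (𝓞 ℚ) ℚ) :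
    ((Rat.finUnitHom y : ideleGroup ℚ) : AdeleRing (𝓞 ℚ) ℚ) * finiteAdeleInr ℚ c =
      finiteAdeleInr ℚ ((y : FiniteAdeleRing (𝓞 ℚ) ℚ) * c) :=
  Prod.ext (mul_zero (1 : InfiniteAdeleRing ℚ)) rfl

/-- **`(1, n(c)) = n((0, c))`**: the finite-adelic unipotent placed in `GL₂(𝔸_ℚ)` is the adelic
unipotent of the adele `(0, c)`. [folklore] -/
theorem ofFinite_unipotentGL2 (c : FiniteAdeleRing (𝓞 ℚ) ℚ) :
    GLn.ofFinite 2 ℚ ((unipotentGL2 c : ↥(upperUnitriangular (Fin 2) (FiniteAdeleRing (𝓞 ℚ) ℚ))) :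
        GL (Fin 2) (FiniteAdeleRing (𝓞 ℚ) ℚ)) =
      ((unipotentGL2 (finiteAdeleInr ℚ c) : ↥(adelicUnipotent 2 ℚ)) : GL (Fin 2) (AdeleRing (𝓞 ℚ) ℚ)) := by
  refine Units.ext ?_
  ext i j
  rw [GLn.coe_ofFinite_apply, coe_unipotentGL2, coe_unipotentGL2]
  fin_cases i <;> fin_cases j <;> rfl

/-- **`(1, d(y)) = d((1, y))`**: the finite-adelic torus element placed in `GL₂(𝔸_ℚ)`. [folklore] -/
theorem ofFinite_diagGL2 (y : (FiniteAdeleRing (𝓞 ℚ) ℚ)ˣ) :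
    GLn.ofFinite 2 ℚ (diagGL2 y 1) = diagGL2 (Rat.finUnitHom y) 1 := by
  refine Units.ext ?_
  ext i j
  rw [GLn.coe_ofFinite_apply, coe_diagGL2, coe_diagGL2]
  fin_cases i <;> fin_cases j <;> rfl

/-- `(h, 1)` commutes with `n((0, c))`. [folklore] -/
theorem ofRealGL_mul_unipotentGL2_finiteAdeleInr (h : GL (Fin 2) ℝ) (c : FiniteAdeleRing (𝓞 ℚ) ℚ) :
    Rat.ofRealGL 2 h * ((unipotentGL2 (finiteAdeleInr ℚ c) : ↥(adelicUnipotent 2 ℚ)) : GL (Fin 2) (AdeleRing (𝓞 ℚ) ℚ)) =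
      ((unipotentGL2 (finiteAdeleInr ℚ c) : ↥(adelicUnipotent 2 ℚ)) : GL (Fin 2) (AdeleRing (𝓞 ℚ) ℚ)) * Rat.ofRealGL 2 h := by
  rw [← ofFinite_unipotentGL2, Rat.ofRealGL_mul_ofFinite_comm]

end FinAdele

/-! ### Tate's character on finite adeles of `ℚ` -/

section Character

/-- **`ψ_ℚ((0, c)) = e^{2πi q}` when `c - q` is integral at every prime** (`q ∈ ℚ`): the case
`K = ℚ` (`Tr_{ℚ/ℚ} = id`) of the tree's `finiteAdeleAddChar_eq_of_forall_sub_mem`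
(`ψ_f(b) = e^{2πi Tr k}` for `b ≡ k`), spelt with `ψ_ℚ` on `(0, c) = finiteAdeleInr ℚ c`.
[cite: CasselsFrohlichANT1967, Ch. XV (Tate), §2.2 and Lemma 4.1.5] -/
theorem Rat.adeleAddChar_finiteAdeleInr_eq_of_sub_integral (c : FiniteAdeleRing (𝓞 ℚ) ℚ) (q : ℚ)
    (h : ∀ v : HeightOneSpectrum (𝓞 ℚ), (c - algebraMap ℚ (FiniteAdeleRing (𝓞 ℚ) ℚ) q) v ∈ v.adicCompletionIntegers ℚ) :
    adeleAddChar ℚ (finiteAdeleInr ℚ c) = AddCircle.toCircle ((q : ℝ) : AddCircle (1 : ℝ)) := by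
  change finiteAdeleAddChar ℚ c = _
  rw [finiteAdeleAddChar_eq_of_forall_sub_mem ℚ h]
  congr 2
  exact_mod_cast Algebra.trace_self_apply q

/-- `e^{2πi/n} ≠ 1` for `n ≥ 2`. [folklore] -/
theorem AddCircle.toCircle_inv_natCast_ne_one {n : ℕ} (hn : 2 ≤ n) :
    AddCircle.toCircle (((n : ℝ)⁻¹ : ℝ) : AddCircle (1 : ℝ)) ≠ 1 := by
  intro h
  rw [← AddCircle.toCircle_zero] at h
  have hinj := AddCircle.injective_toCircle one_ne_zero h
  rw [AddCircle.coe_eq_zero_iff] at hinj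
  obtain ⟨k, hk⟩ := hinj
  rw [zsmul_eq_mul, mul_one] at hk
  have hn0 : (0 : ℝ) < n := by exact_mod_cast (by omega : 0 < n)
  have hlt : (n : ℝ)⁻¹ < 1 := inv_lt_one_of_one_lt₀ (by exact_mod_cast hn)
  have hpos : 0 < (n : ℝ)⁻¹ := inv_pos.2 hn0
  rw [← hk] at hlt hpos
  have h1 : (0 : ℤ) < k := by exact_mod_cast hpos
  have h2 : k < (1 : ℤ) := by exact_mod_cast hlt
  omega

/-- The finite adele `(p⁻¹ at p, 0 elsewhere)`. [folklore] -/
def Rat.invPrimeSingle (v : HeightOneSpectrum (𝓞 ℚ)) : FiniteAdeleRing (𝓞 ℚ) ℚ :=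
  finiteAdeleSingleHom ℚ v (algebraMap ℚ (FiniteAdeleRing (𝓞 ℚ) ℚ) ((natGenerator v : ℚ)⁻¹) v)

/-- **The local conductor of `ψ_ℚ` at `p` is exactly `ℤ_p`**: for the finite adele `c` with
`c_p = p⁻¹` and `c_ℓ = 0` for `ℓ ≠ p`, `ψ_ℚ((0, c)) = e^{2πi/p}` — since `c ≡ p⁻¹ (mod ẑ)`
(`p⁻¹ ∈ ℤ_ℓ` for `ℓ ≠ p`). [cite: CasselsFrohlichANT1967, Ch. XV (Tate), Lemma 2.2.3] -/
theorem Rat.adeleAddChar_finiteAdeleInr_invPrimeSingle (v : HeightOneSpectrum (𝓞 ℚ)) :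
    adeleAddChar ℚ (finiteAdeleInr ℚ (Rat.invPrimeSingle v)) =
      AddCircle.toCircle ((((natGenerator v : ℚ)⁻¹ : ℚ) : ℝ) : AddCircle (1 : ℝ)) := by
  refine Rat.adeleAddChar_finiteAdeleInr_eq_of_sub_integral _ _ fun w => ?_
  rw [HeightOneSpectrum.mem_adicCompletionIntegers, FiniteAdeleRing.sub_apply']
  by_cases hw : w = v
  · subst hw
    rw [Rat.invPrimeSingle, finiteAdeleSingleHom_apply_self, sub_self, Valuation.map_zero]
    exact zero_le
  · rw [Rat.invPrimeSingle, finiteAdeleSingleHom_apply_of_ne _ _ _ hw, zero_sub, Valuation.map_neg,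
      FiniteAdeleRing.algebraMap_apply, valuedAdicCompletion_eq_valuation', map_inv₀,
      Rat.valuation_natGenerator_of_ne hw, inv_one]

/-- `ψ_ℚ((0, p⁻¹ at p)) ≠ 1`. [cite: CasselsFrohlichANT1967, Ch. XV (Tate), Lemma 2.2.3] -/
theorem Rat.adeleAddChar_finiteAdeleInr_invPrimeSingle_ne_one (v : HeightOneSpectrum (𝓞 ℚ)) :
    adeleAddChar ℚ (finiteAdeleInr ℚ (Rat.invPrimeSingle v)) ≠ 1 := by
  rw [Rat.adeleAddChar_finiteAdeleInr_invPrimeSingle, Rat.cast_inv, Rat.cast_natCast]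
  exact AddCircle.toCircle_inv_natCast_ne_one (prime_natGenerator v).two_le

/-- **Witness of non-integrality**: if the finite idele `y` is not integral at `p`, there is
`z ∈ ẑ` with `ψ_ℚ((0, y z)) ≠ 1` — namely `z = y⁻¹ · (p⁻¹ at p)`, integral because
`|y_p|_p > 1`. [cite: CasselsFrohlichANT1967, Ch. XV (Tate), Lemma 2.2.3] -/
theorem Rat.exists_integral_adeleAddChar_finiteAdeleInr_mul_ne_one {y : (FiniteAdeleRing (𝓞 ℚ) ℚ)ˣ}
    {v : HeightOneSpectrum (𝓞 ℚ)} (hy : (y : FiniteAdeleRing (𝓞 ℚ) ℚ) v ∉ v.adicCompletionIntegers ℚ) :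
    ∃ z : FiniteAdeleRing (𝓞 ℚ) ℚ, (∀ w : HeightOneSpectrum (𝓞 ℚ), z w ∈ w.adicCompletionIntegers ℚ) ∧
      adeleAddChar ℚ (finiteAdeleInr ℚ ((y : FiniteAdeleRing (𝓞 ℚ) ℚ) * z)) ≠ 1 := by
  refine ⟨((y⁻¹ : (FiniteAdeleRing (𝓞 ℚ) ℚ)ˣ) : FiniteAdeleRing (𝓞 ℚ) ℚ) * Rat.invPrimeSingle v, fun w => ?_, ?_⟩
  · rw [HeightOneSpectrum.mem_adicCompletionIntegers, FiniteAdeleRing.mul_apply', Valuation.map_mul]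
    by_cases hw : w = v
    · subst hw
      rw [HeightOneSpectrum.mem_adicCompletionIntegers, not_le] at hy
      -- `|y_v⁻¹|_v = |y_v|_v⁻¹ ≤ exp(-1)` and `|p⁻¹|_v = exp 1`
      have hmul : ((y : FiniteAdeleRing (𝓞 ℚ) ℚ) w) * ((((y⁻¹ : (FiniteAdeleRing (𝓞 ℚ) ℚ)ˣ) : FiniteAdeleRing (𝓞 ℚ) ℚ) w)) = 1 := by
        rw [← FiniteAdeleRing.mul_apply', Units.mul_inv]; rfl
      have hyinv : Valued.v ((((y⁻¹ : (FiniteAdeleRing (𝓞 ℚ) ℚ)ˣ) : FiniteAdeleRing (𝓞 ℚ) ℚ) w)) =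
          (Valued.v ((y : FiniteAdeleRing (𝓞 ℚ) ℚ) w))⁻¹ := by
        rw [eq_inv_of_mul_eq_one_right hmul, map_inv₀]
      have hp : Valued.v (Rat.invPrimeSingle w w) = WithZero.exp (1 : ℤ) := by
        rw [Rat.invPrimeSingle, finiteAdeleSingleHom_apply_self, FiniteAdeleRing.algebraMap_apply,
          valuedAdicCompletion_eq_valuation', map_inv₀, Rat.valuation_natGenerator_self, ← WithZero.exp_neg, neg_neg]
      have hne : Valued.v ((y : FiniteAdeleRing (𝓞 ℚ) ℚ) w) ≠ 0 := ne_of_gt (lt_trans zero_lt_one hy)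
      set n : ℤ := WithZero.log (Valued.v ((y : FiniteAdeleRing (𝓞 ℚ) ℚ) w)) with hn
      have hm : Valued.v ((y : FiniteAdeleRing (𝓞 ℚ) ℚ) w) = WithZero.exp n := (WithZero.exp_log hne).symm
      have hm1 : 1 ≤ n := by
        rw [hm, ← WithZero.exp_zero, WithZero.exp_lt_exp] at hy
        omega
      rw [hyinv, hp, hm, ← WithZero.exp_neg, ← WithZero.exp_add, ← WithZero.exp_zero, WithZero.exp_le_exp]
      omega
    · rw [Rat.invPrimeSingle, finiteAdeleSingleHom_apply_of_ne _ _ _ hw, Valuation.map_zero, mul_zero]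
      exact zero_le
  · rw [← mul_assoc, ← Units.val_mul, mul_inv_cancel, Units.val_one, one_mul]
    exact Rat.adeleAddChar_finiteAdeleInr_invPrimeSingle_ne_one v

end Character

/-! ### Whittaker coefficients along the finite-adelic mirabolic -/

section Whittaker

variable [MeasurableSpace ↥(adelicUnipotent 2 ℚ)]
  {ν : Measure ↥(adelicUnipotent 2 ℚ)} {𝓕 : Set ↥(adelicUnipotent 2 ℚ)}
  {ψ : AddChar (AdeleRing (𝓞 ℚ) ℚ) Circle} {φ : GL (Fin 2) (AdeleRing (𝓞 ℚ) ℚ) → ℂ}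

/-- **`W_φ((h, d(y) n(c))) = ψ((0, y c)) W_φ((h, d(y)))`**: `d(y) n(c) = n(y c) d(y)` in
`GL₂(𝔸_ℚ^∞)`, `(h, 1)` commutes with finite unipotents, and `W_φ(n g) = ψ(n) W_φ(g)`
(`whittakerCoeff_unipotent_mul`; Cogdell 2004, §1.1). [cite: CogdellAnalyticTheory2004, §1.1] -/
theorem whittakerCoeff_ofRealGL_mul_ofFinite_diagGL2_mul_unipotentGL2 [MeasurableMul ↥(adelicUnipotent 2 ℚ)]
    [Countable ↥(rationalUnipotent 2 ℚ)]
    [MeasurableConstSMul ↥(rationalUnipotent 2 ℚ) ↥(adelicUnipotent 2 ℚ)]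
    [SMulInvariantMeasure ↥(rationalUnipotent 2 ℚ) ↥(adelicUnipotent 2 ℚ) ν]
    [ν.IsMulRightInvariant]
    (h𝓕 : IsFundamentalDomain ↥(rationalUnipotent 2 ℚ) 𝓕 ν) (hψ : IsGlobalAddChar ℚ ψ)
    (hφ : IsLeftInvariant (AdelicGroupData.gl 2 ℚ) φ)
    (h : GL (Fin 2) ℝ) (y : (FiniteAdeleRing (𝓞 ℚ) ℚ)ˣ) (c : FiniteAdeleRing (𝓞 ℚ) ℚ) :
    whittakerCoeff ν 𝓕 ψ φ (Rat.ofRealGL 2 h * GLn.ofFinite 2 ℚ (diagGL2 y 1 *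
      ((unipotentGL2 c : ↥(upperUnitriangular (Fin 2) (FiniteAdeleRing (𝓞 ℚ) ℚ))) : GL (Fin 2) (FiniteAdeleRing (𝓞 ℚ) ℚ)))) =
      ψ (finiteAdeleInr ℚ ((y : FiniteAdeleRing (𝓞 ℚ) ℚ) * c)) *
        whittakerCoeff ν 𝓕 ψ φ (Rat.ofRealGL 2 h * GLn.ofFinite 2 ℚ (diagGL2 y 1)) := by
  rw [diagGL2_mul_unipotentGL2, map_mul, ofFinite_unipotentGL2, ← mul_assoc, ofRealGL_mul_unipotentGL2_finiteAdeleInr,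
    mul_assoc, whittakerCoeff_unipotent_mul h𝓕 hψ hφ, whittakerCharFun_unipotentGL2]

/-- `W_φ((h, d(y)) (1, k)) = W_{r(1,k) φ}((h, d(y)))` (right translations, `whittakerCoeff_mul_right`),
spelt with `rightTranslation`. [folklore] -/
theorem whittakerCoeff_mul_ofFinite_eq_rightTranslation (g : GL (Fin 2) (AdeleRing (𝓞 ℚ) ℚ))
    (k : GL (Fin 2) (FiniteAdeleRing (𝓞 ℚ) ℚ)) :
    whittakerCoeff ν 𝓕 ψ φ (g * GLn.ofFinite 2 ℚ k) =
      whittakerCoeff ν 𝓕 ψ (rightTranslation (AdelicGroupData.gl 2 ℚ) (GLn.ofFinite 2 ℚ k) φ) g :=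
  whittakerCoeff_mul_right ν 𝓕 ψ φ g _

/-- **Support of the Whittaker coefficient of an `n(ẑ)`-fixed `φ` along the torus**: if
`φ(x n(z)) = φ(x)` for all `z ∈ ẑ` and `ψ((0, y z)) ≠ 1` for some `z ∈ ẑ`, then `W_φ((h, d(y))) = 0`
(`W_φ((h, d(y))) = W_φ((h, d(y) n(z))) = ψ((0, y z)) W_φ((h, d(y)))`). For Tate's character this is the
vanishing of the Kirillov function of an `n(ℤ_p)`-fixed vector off `ℤ_p` (Casselman 1973, §1).
[cite: Casselman1973, §1] -/
theorem whittakerCoeff_ofRealGL_mul_ofFinite_diagGL2_eq_zero [MeasurableMul ↥(adelicUnipotent 2 ℚ)]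
    [Countable ↥(rationalUnipotent 2 ℚ)]
    [MeasurableConstSMul ↥(rationalUnipotent 2 ℚ) ↥(adelicUnipotent 2 ℚ)]
    [SMulInvariantMeasure ↥(rationalUnipotent 2 ℚ) ↥(adelicUnipotent 2 ℚ) ν]
    [ν.IsMulRightInvariant]
    (h𝓕 : IsFundamentalDomain ↥(rationalUnipotent 2 ℚ) 𝓕 ν) (hψ : IsGlobalAddChar ℚ ψ)
    (hφ : IsLeftInvariant (AdelicGroupData.gl 2 ℚ) φ)
    (hfix : ∀ z : FiniteAdeleRing (𝓞 ℚ) ℚ, (∀ w : HeightOneSpectrum (𝓞 ℚ), z w ∈ w.adicCompletionIntegers ℚ) →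
      ∀ x, φ (x * GLn.ofFinite 2 ℚ ((unipotentGL2 z : ↥(upperUnitriangular (Fin 2) (FiniteAdeleRing (𝓞 ℚ) ℚ))) :
        GL (Fin 2) (FiniteAdeleRing (𝓞 ℚ) ℚ))) = φ x)
    (h : GL (Fin 2) ℝ) {y : (FiniteAdeleRing (𝓞 ℚ) ℚ)ˣ} {z : FiniteAdeleRing (𝓞 ℚ) ℚ}
    (hz : ∀ w : HeightOneSpectrum (𝓞 ℚ), z w ∈ w.adicCompletionIntegers ℚ)
    (hne : ψ (finiteAdeleInr ℚ ((y : FiniteAdeleRing (𝓞 ℚ) ℚ) * z)) ≠ 1) :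
    whittakerCoeff ν 𝓕 ψ φ (Rat.ofRealGL 2 h * GLn.ofFinite 2 ℚ (diagGL2 y 1)) = 0 := by
  have e := whittakerCoeff_ofRealGL_mul_ofFinite_diagGL2_mul_unipotentGL2 h𝓕 hψ hφ h y z (ν := ν)
  rw [map_mul, ← mul_assoc, whittakerCoeff_mul_of_forall ν 𝓕 ψ (hfix z hz)] at e
  have e' : (1 - (ψ (finiteAdeleInr ℚ ((y : FiniteAdeleRing (𝓞 ℚ) ℚ) * z)) : ℂ)) *
      whittakerCoeff ν 𝓕 ψ φ (Rat.ofRealGL 2 h * GLn.ofFinite 2 ℚ (diagGL2 y 1)) = 0 := by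
    rw [sub_mul, one_mul, ← e, sub_self]
  refine (mul_eq_zero.1 e').resolve_left fun h0 => hne ?_
  rw [sub_eq_zero] at h0
  exact Subtype.ext h0.symm

end Whittaker

end Literature.NumberTheory.Automorphic

end
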